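import Summits.NavierStokesRegularity.NavierStokesRegularity.Theses.TypeICertificateLadder
import Summits.NavierStokesRegularity.NavierStokesRegularity.Theses.ThreadingFlux
import Summits.NavierStokesRegularity.NavierStokesRegularity.Theses.ExtremalTypeIConstant
import Summits.NavierStokesRegularity.NavierStokesRegularity.Theses.SymmetryModuliCount
import Summits.NavierStokesRegularity.NavierStokesRegularity.Theorems.TypeICertificateLadderTargetRateClassLiouville
import Summits.NavierStokesRegularity.NavierStokesRegularity.Theorems.TypeICertificateLadderTargetOfForcedSymmetry
import Summits.NavierStokesRegularity.NavierStokesRegularity.Theorems.TypeICertificateLadderTargetSolitonBridgeEmbedding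
import Summits.NavierStokesRegularity.NavierStokesRegularity.Theorems.TypeICertificateLadderTargetSolitonBridgeGenerator
import Literature.Analysis.FluidPDE.PineauVicolRSS
import Literature.Analysis.FluidPDE.TypeIAncientMild
import Literature.Analysis.FluidPDE.SwirlTransportProofs
import HarnessLib

/-!
# Crux `Target` ≡ `NoTypeIBlowup` (stmt-NavierStokesRegularity-1217), line `killing-twisted-bernoulli-solitons`:
# the position of the line's two OPEN stubs in the summit's item DAG (kernel-checked bridges)

Lead `prover-line-stmt-NavierStokesRegularity-1217-c3-0` (continuation lead c3), 2026-08-16.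

The skeleton of the line (`Cruxes/Target/Lines/killing_twisted_bernoulli_solitons.lean`) concludes the
crux from six registered stubs, four of which are landed (B1–B4). The two that remain are OPEN
MATHEMATICS: A2' `stub_solitonSelection` (a non-trivial element of the Oseen-gauge rate class
`IsTypeIAncientMild C` forces a non-trivial Type-I rotated self-similar soliton of Pineau–Vicol's class)
and B5b `stub_windowLiouville` (Pineau–Vicol's Conjecture 1.1 in a compact window of rotation rates).
This file does not attack either. It proves, from the landed embedding `solitonBridge_isTypeIAncientMild`
(the ansatz field of a Pineau–Vicol-class RSS solution is a rate-class element on all `t < 0`) and the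
landed infinitesimal symmetry `solitonBridge_generator` (that element is annihilated by the spiral-scaling
generator `∇v·(x + Ax) + v + 2t∂ₜv − Av`, `A = −2αJ`), WHERE the two open stubs sit among the EXISTING
items of the sibling routes:

* `solitonBridge_rssLiouville_of_spiralScalingLiouville` — Liouville for ALL Type-I RSS solutions of
  Pineau–Vicol's class (their Conj. 1.1 in full, hence B5b) FOLLOWS from
  `ExtremalTypeIConstant.SpiralScalingLiouville` (stmt-NavierStokesRegularity-8216);
* `solitonBridge_rssLiouville_of_symmetricLiouville` — … and from
  `SymmetryModuliCount.SymmetricLiouville` (stmt-4053, the `σ = 1`, `a = 0`, `A = −2αJ` instance);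
* `solitonBridge_rssLiouville_of_typeIAncientLiouville` — … and (trivially) from
  `SymmetryModuliCount.TypeIAncientLiouville` (stmt-4050);
* `solitonBridge_solitonSelection_of_rateClassLiouville`, `…_of_forcedSymmetry`,
  `solitonBridge_solitonSelection_iff_rateClassLiouville` — A2' is implied by rate-class Liouville
  (vacuously), hence by `SymmetryModuliCount.ForcedSymmetry` (stmt-4052) through the landed time-anchor
  collapse, and MODULO soliton Liouville in P–V's class it is EQUIVALENT to rate-class Liouville
  (the costume check: given the B-side, the external stub is the crux core, exactly as
  `headInfluxLaw_iff_rateClassLiouville` (p95070) was for the dead line `head-flux-channel`);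
* `solitonBridge_noTypeIBlowup_of_solitonSelection_of_spiralScalingLiouville` — the crux from A2' and
  stmt-8216 (the line's composition with B5b replaced by the sibling item), and
  `solitonBridge_windowLiouville_of_spiralScalingLiouville` — B5b VERBATIM (the registered signature of
  `stub_windowLiouville`) from stmt-8216.

Consequence for planners: B5b ⊂ 8216 ⊂ 4053 and A2' ⇐ 4052, with 4050 ⇔ 4052 ∧ 4053 on route
`SymmetryModuliCount`; neither open stub of this line needs to be filed as a new item. The gap between
B5b and 8216 is exactly the apex decay `‖u‖ ≤ C₀/(‖x‖+√−t)` (8216 allows merely bounded profiles).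
CONDITIONAL theorems (hypotheses are open items); nothing here closes stmt-1217. No definitions.
-/

noncomputable section

set_option linter.dupNamespace false

namespace Summit.NavierStokesRegularity.NavierStokesRegularity.Theorems

open Set Function
open scoped RealInnerProductSpace
open Literature.Analysis.FluidPDE

/-- The profile of a classical rotated-self-similar datum is `C¹` (indeed smooth): at `t = −1` the
ansatz is the identity (`pvAnsatz_neg_one`), so `U = u(−1, ·)` is a smooth slice of the classical
solution. [folklore] -/
theorem solitonBridge_profile_contDiff_one {α : ℝ}
    {u : ℝ → EuclideanSpace ℝ (Fin 3) → EuclideanSpace ℝ (Fin 3)}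
    {p : ℝ → EuclideanSpace ℝ (Fin 3) → ℝ} {U : EuclideanSpace ℝ (Fin 3) → EuclideanSpace ℝ (Fin 3)}
    (hsol : IsClassicalNSSolutionOn (Ico (-1) 0) 1 0 u p)
    (hA : ∀ t ∈ Ico (-1 : ℝ) 0, ∀ x : EuclideanSpace ℝ (Fin 3), u t x = pvAnsatz α (fun y _ => U y) t x) :
    ContDiff ℝ 1 U := by
  have hmem : (-1 : ℝ) ∈ Ico (-1 : ℝ) 0 := ⟨le_rfl, by norm_num⟩
  have hUeq : U = u (-1) := by
    funext y
    rw [hA (-1) hmem y, pvAnsatz_neg_one]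
  rw [hUeq]
  exact (hsol.contDiff_velocity hmem).of_le (by exact_mod_cast le_top)

/-- The linear part `A = −2αJ` of the spiral-scaling generator of the RSS ansatz is skew:
`⟪A x, x⟫ = −2α ⟪Jx, x⟫ = 0`. [folklore] -/
theorem solitonBridge_skew (α : ℝ) (x : EuclideanSpace ℝ (Fin 3)) :
    inner ℝ (((-(2 * α)) • rotGenL) x) x = 0 := by
  show inner ℝ ((-(2 * α)) • rotGen x) x = 0
  rw [inner_smul_left, inner_rotGen_self, mul_zero]

/-- **A Pineau–Vicol-class RSS solution whose ansatz field vanishes on `t < 0` has zero profile**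
(evaluate at `t = −1`, where the ansatz is the identity). [folklore] -/
theorem solitonBridge_profile_eq_zero_of_ansatz_eq_zero {α : ℝ}
    {U : EuclideanSpace ℝ (Fin 3) → EuclideanSpace ℝ (Fin 3)}
    (hzero : ∀ t < 0, ∀ x, pvAnsatz α (fun y _ => U y) t x = 0) : U = 0 := by
  funext y
  have h := hzero (-1) (by norm_num) y
  rw [pvAnsatz_neg_one] at h
  exact h

/-- **Soliton Liouville in Pineau–Vicol's class (all `α`) from `SpiralScalingLiouville`
(stmt-NavierStokesRegularity-8216, route `ExtremalTypeIConstant`).** If every element of the rate class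
invariant under a one-parameter spiral-scaling group vanishes, then every classical Type-I
(`‖u(t,x)‖ ≤ C₀/(‖x‖+√−t)`) rotated self-similar solution on `[−1,0)` with a `C²` profile has `U = 0`,
for EVERY rotation rate `α` (Pineau–Vicol's Conjecture 1.1 in their class): the ansatz field is a
rate-class element (`solitonBridge_isTypeIAncientMild`) annihilated by the generator with `a = 0`,
`A = −2αJ` (`solitonBridge_generator`), so it vanishes on `t < 0`, and at `t = −1` it is `U`.
CONDITIONAL on the open item 8216. [cite: PineauVicol2026, Conjecture 1.1 and Remark 1.2 (arXiv:2607.09619 pp. 3–4)] -/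
theorem solitonBridge_rssLiouville_of_spiralScalingLiouville
    (h8216 : Summit.NavierStokesRegularity.NavierStokesRegularity.Theses.ExtremalTypeIConstant.SpiralScalingLiouville) :
    ∀ C₀ : ℝ, 0 < C₀ → ∀ (α : ℝ) (u : ℝ → EuclideanSpace ℝ (Fin 3) → EuclideanSpace ℝ (Fin 3)) (p : ℝ → EuclideanSpace ℝ (Fin 3) → ℝ) (U : EuclideanSpace ℝ (Fin 3) → EuclideanSpace ℝ (Fin 3)), Literature.Analysis.FluidPDE.IsClassicalNSSolutionOn (Set.Ico (-1) 0) 1 0 u p → (∀ t ∈ Set.Ico (-1 : ℝ) 0, ∀ x : EuclideanSpace ℝ (Fin 3), ‖u t x‖ ≤ C₀ / (‖x‖ + Real.sqrt (-t))) → ContDiff ℝ 2 U → (∀ t ∈ Set.Ico (-1 : ℝ) 0, ∀ x : EuclideanSpace ℝ (Fin 3), u t x = Literature.Analysis.FluidPDE.pvAnsatz α (fun y _ => U y) t x) → U = 0 := by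
  intro C₀ _hC₀ α u p U hsol hI _hU hA
  obtain ⟨hK, -, -⟩ := solitonBridge_isTypeIAncientMild C₀ α u p U hsol hI hA
  have hU1 : ContDiff ℝ 1 U := solitonBridge_profile_contDiff_one hsol hA
  refine solitonBridge_profile_eq_zero_of_ansatz_eq_zero
    (h8216 C₀ _ (isTypeIAncientMild_iff.1 hK) ⟨0, (-(2 * α)) • rotGenL, solitonBridge_skew α, ?_⟩)
  intro t ht x
  simpa only [zero_add] using solitonBridge_generator α U hU1 t ht x

/-- **Soliton Liouville in Pineau–Vicol's class (all `α`) from `SymmetricLiouville`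
(stmt-NavierStokesRegularity-4053, route `SymmetryModuliCount`)** — the instance `ξ = (a, σ, A) =
(0, 1, −2αJ)` of the discrete-stabiliser statement, through the same embedding and generator.
CONDITIONAL on the open item 4053. [cite: PineauVicol2026, Conjecture 1.1 (arXiv:2607.09619 p. 3)] -/
theorem solitonBridge_rssLiouville_of_symmetricLiouville
    (h4053 : Summit.NavierStokesRegularity.NavierStokesRegularity.Theses.SymmetryModuliCount.SymmetricLiouville) :
    ∀ C₀ : ℝ, 0 < C₀ → ∀ (α : ℝ) (u : ℝ → EuclideanSpace ℝ (Fin 3) → EuclideanSpace ℝ (Fin 3)) (p : ℝ → EuclideanSpace ℝ (Fin 3) → ℝ) (U : EuclideanSpace ℝ (Fin 3) → EuclideanSpace ℝ (Fin 3)), Literature.Analysis.FluidPDE.IsClassicalNSSolutionOn (Set.Ico (-1) 0) 1 0 u p → (∀ t ∈ Set.Ico (-1 : ℝ) 0, ∀ x : EuclideanSpace ℝ (Fin 3), ‖u t x‖ ≤ C₀ / (‖x‖ + Real.sqrt (-t))) → ContDiff ℝ 2 U → (∀ t ∈ Set.Ico (-1 : ℝ) 0, ∀ x : EuclideanSpace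 ℝ (Fin 3), u t x = Literature.Analysis.FluidPDE.pvAnsatz α (fun y _ => U y) t x) → U = 0 := by
  intro C₀ _hC₀ α u p U hsol hI _hU hA
  obtain ⟨hK, -, -⟩ := solitonBridge_isTypeIAncientMild C₀ α u p U hsol hI hA
  have hU1 : ContDiff ℝ 1 U := solitonBridge_profile_contDiff_one hsol hA
  refine solitonBridge_profile_eq_zero_of_ansatz_eq_zero
    (h4053 C₀ _ (isTypeIAncientMild_iff.1 hK) 0 1 ((-(2 * α)) • rotGenL) (solitonBridge_skew α) ?_ ?_)
  · rintro ⟨-, h1, -⟩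
    exact one_ne_zero h1
  · intro t ht x
    simpa only [zero_add, one_smul, mul_one] using solitonBridge_generator α U hU1 t ht x

/-- **Soliton Liouville in Pineau–Vicol's class (all `α`) from `TypeIAncientLiouville`
(stmt-NavierStokesRegularity-4050 = rate-class Liouville in the KNSS gauge)** — only the embedding is
used. CONDITIONAL on the open item 4050. [cite: PineauVicol2026, Conjecture 1.1 (arXiv:2607.09619 p. 3)] -/
theorem solitonBridge_rssLiouville_of_typeIAncientLiouville
    (h4050 : Summit.NavierStokesRegularity.NavierStokesRegularity.Theses.SymmetryModuliCount.TypeIAncientLiouville) :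
    ∀ C₀ : ℝ, 0 < C₀ → ∀ (α : ℝ) (u : ℝ → EuclideanSpace ℝ (Fin 3) → EuclideanSpace ℝ (Fin 3)) (p : ℝ → EuclideanSpace ℝ (Fin 3) → ℝ) (U : EuclideanSpace ℝ (Fin 3) → EuclideanSpace ℝ (Fin 3)), Literature.Analysis.FluidPDE.IsClassicalNSSolutionOn (Set.Ico (-1) 0) 1 0 u p → (∀ t ∈ Set.Ico (-1 : ℝ) 0, ∀ x : EuclideanSpace ℝ (Fin 3), ‖u t x‖ ≤ C₀ / (‖x‖ + Real.sqrt (-t))) → ContDiff ℝ 2 U → (∀ t ∈ Set.Ico (-1 : ℝ) 0, ∀ x : EuclideanSpace ℝ (Fin 3), u t x = Literature.Analysis.FluidPDE.pvAnsatz α (fun y _ => U y) t x) → U = 0 := by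
  intro C₀ _hC₀ α u p U hsol hI _hU hA
  obtain ⟨hK, -, -⟩ := solitonBridge_isTypeIAncientMild C₀ α u p U hsol hI hA
  exact solitonBridge_profile_eq_zero_of_ansatz_eq_zero (h4050 C₀ _ (isTypeIAncientMild_iff.1 hK))

/-- **A2' (`stub_solitonSelection`) is IMPLIED by rate-class Liouville** — vacuously: under Liouville the
rate class has no non-trivial element. Pure logic. [folklore] -/
theorem solitonBridge_solitonSelection_of_rateClassLiouville
    (hRCL : ∀ C : ℝ, 0 < C → ∀ v : ℝ → EuclideanSpace ℝ (Fin 3) → EuclideanSpace ℝ (Fin 3), Literature.Analysis.FluidPDE.IsTypeIAncientMild C v → ∀ t < 0, ∀ x, v t x = 0) :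
    ∀ (C : ℝ), 0 < C → ∀ (v : ℝ → EuclideanSpace ℝ (Fin 3) → EuclideanSpace ℝ (Fin 3)), Literature.Analysis.FluidPDE.IsTypeIAncientMild C v → ¬ (∀ t < 0, ∀ x, v t x = 0) → ∃ C₀ : ℝ, 0 < C₀ ∧ ∃ (α : ℝ) (u : ℝ → EuclideanSpace ℝ (Fin 3) → EuclideanSpace ℝ (Fin 3)) (p : ℝ → EuclideanSpace ℝ (Fin 3) → ℝ) (U : EuclideanSpace ℝ (Fin 3) → EuclideanSpace ℝ (Fin 3)), Literature.Analysis.FluidPDE.IsClassicalNSSolutionOn (Set.Ico (-1) 0) 1 0 u p ∧ (∀ t ∈ Set.Ico (-1 : ℝ) 0, ∀ x : EuclideanSpace ℝ (Fin 3), ‖u t x‖ ≤ C₀ / (‖x‖ + Real.sqrt (-t))) ∧ ContDiff ℝ 2 U ∧ (∀ t ∈ Set.Ico (-1 : ℝ) 0, ∀ x : EuclideanSpace ℝ (Fin 3), u t x = Literature.Analysis.FluidPDE.pvAnsatz α (fun y _ => U y) t x) ∧ U ≠ 0 :=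
  fun C hC v hv hnz => absurd (hRCL C hC v hv) hnz

/-- **Costume check for A2'.** Modulo soliton Liouville in Pineau–Vicol's class for all `α` (the
B-side of the line: tree Thm 1.4, landed B1–B4, open B5b), the external stub A2' is EQUIVALENT to
rate-class Type-I Liouville `∀ C > 0, IsTypeIAncientMild C v → v ≡ 0 on t < 0` — the crux core
(which gives the crux by `noTypeIBlowup_of_rateClassLiouville`, p94280). So, given the B-side, the
line's one external leaf IS the Type-I Liouville problem in costume, as `headInfluxLaw_iff_rateClassLiouville`
was for the line `head-flux-channel`. Pure logic. [folklore] -/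
theorem solitonBridge_solitonSelection_iff_rateClassLiouville
    (hL : ∀ C₀ : ℝ, 0 < C₀ → ∀ (α : ℝ) (u : ℝ → EuclideanSpace ℝ (Fin 3) → EuclideanSpace ℝ (Fin 3)) (p : ℝ → EuclideanSpace ℝ (Fin 3) → ℝ) (U : EuclideanSpace ℝ (Fin 3) → EuclideanSpace ℝ (Fin 3)), Literature.Analysis.FluidPDE.IsClassicalNSSolutionOn (Set.Ico (-1) 0) 1 0 u p → (∀ t ∈ Set.Ico (-1 : ℝ) 0, ∀ x : EuclideanSpace ℝ (Fin 3), ‖u t x‖ ≤ C₀ / (‖x‖ + Real.sqrt (-t))) → ContDiff ℝ 2 U → (∀ t ∈ Set.Ico (-1 : ℝ) 0, ∀ x : EuclideanSpace ℝ (Fin 3), u t x = Literature.Analysis.FluidPDE.pvAnsatz α (fun y _ => U y) t x) → U = 0) :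
    (∀ (C : ℝ), 0 < C → ∀ (v : ℝ → EuclideanSpace ℝ (Fin 3) → EuclideanSpace ℝ (Fin 3)), Literature.Analysis.FluidPDE.IsTypeIAncientMild C v → ¬ (∀ t < 0, ∀ x, v t x = 0) → ∃ C₀ : ℝ, 0 < C₀ ∧ ∃ (α : ℝ) (u : ℝ → EuclideanSpace ℝ (Fin 3) → EuclideanSpace ℝ (Fin 3)) (p : ℝ → EuclideanSpace ℝ (Fin 3) → ℝ) (U : EuclideanSpace ℝ (Fin 3) → EuclideanSpace ℝ (Fin 3)), Literature.Analysis.FluidPDE.IsClassicalNSSolutionOn (Set.Ico (-1) 0) 1 0 u p ∧ (∀ t ∈ Set.Ico (-1 : ℝ) 0, ∀ x : EuclideanSpace ℝ (Fin 3), ‖u t x‖ ≤ C₀ / (‖x‖ + Real.sqrt (-t))) ∧ ContDiff ℝ 2 U ∧ (∀ t ∈ Set.Ico (-1 : ℝ) 0, ∀ x : EuclideanSpace ℝ (Fin 3), u t x = Literature.Analysis.FluidPDE.pvAnsatz α (fun y _ => U y) t x) ∧ U ≠ 0) ↔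
    (∀ C : ℝ, 0 < C → ∀ v : ℝ → EuclideanSpace ℝ (Fin 3) → EuclideanSpace ℝ (Fin 3), Literature.Analysis.FluidPDE.IsTypeIAncientMild C v → ∀ t < 0, ∀ x, v t x = 0) := by
  constructor
  · intro hA2 C hC v hv
    by_contra hnz
    obtain ⟨C₀, hC₀, α, u, p, U, hns, hI, hU, hA, hU0⟩ := hA2 C hC v hv hnz
    exact hU0 (hL C₀ hC₀ α u p U hns hI hU hA)
  · exact solitonBridge_solitonSelection_of_rateClassLiouville

/-- **A2' from `ForcedSymmetry` (stmt-NavierStokesRegularity-4052)**, through the landed time-anchor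
collapse `typeIAncientLiouville_of_forcedSymmetry_of_killingLeaves` fed with the PROVED Killing-leaf items
(stmt-14061/14062): forced symmetry gives rate-class Liouville, under which A2' is vacuous.
CONDITIONAL on the open item 4052. [folklore] -/
theorem solitonBridge_solitonSelection_of_forcedSymmetry
    (hF : Summit.NavierStokesRegularity.NavierStokesRegularity.Theses.SymmetryModuliCount.ForcedSymmetry) :
    ∀ (C : ℝ), 0 < C → ∀ (v : ℝ → EuclideanSpace ℝ (Fin 3) → EuclideanSpace ℝ (Fin 3)), Literature.Analysis.FluidPDE.IsTypeIAncientMild C v → ¬ (∀ t < 0, ∀ x, v t x = 0) → ∃ C₀ : ℝ, 0 < C₀ ∧ ∃ (α : ℝ) (u : ℝ → EuclideanSpace ℝ (Fin 3) → EuclideanSpace ℝ (Fin 3)) (p : ℝ → EuclideanSpace ℝ (Fin 3) → ℝ) (U : EuclideanSpace ℝ (Fin 3) → EuclideanSpace ℝ (Fin 3)), Literature.Analysis.FluidPDE.IsClassicalNSSolutionOn (Set.Ico (-1) 0) 1 0 u p ∧ (∀ t ∈ Set.Ico (-1 : ℝ) 0, ∀ x : EuclideanSpace ℝ (Fin 3),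 ‖u t x‖ ≤ C₀ / (‖x‖ + Real.sqrt (-t))) ∧ ContDiff ℝ 2 U ∧ (∀ t ∈ Set.Ico (-1 : ℝ) 0, ∀ x : EuclideanSpace ℝ (Fin 3), u t x = Literature.Analysis.FluidPDE.pvAnsatz α (fun y _ => U y) t x) ∧ U ≠ 0 := by
  have hX := typeIAncientLiouville_of_forcedSymmetry_of_killingLeaves
    symmetryModuliCount_helicalEndLiouville_proof AxisymEndLiouville_of hF
  exact solitonBridge_solitonSelection_of_rateClassLiouville
    fun C _ v hv => hX C v (isTypeIAncientMild_iff.1 hv)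

/-- **The crux from A2' and stmt-8216** (the line's composition with its open window stub B5b
replaced by the sibling item `SpiralScalingLiouville`): a non-trivial rate-class element would give a
non-trivial P–V-class soliton (A2'), which `solitonBridge_rssLiouville_of_spiralScalingLiouville` kills;
so the rate class is trivial and `noTypeIBlowup_of_rateClassLiouville` (p94280) concludes the crux BY
NAME. CONDITIONAL on A2' (open) and stmt-8216 (open). [folklore] -/
theorem solitonBridge_noTypeIBlowup_of_solitonSelection_of_spiralScalingLiouville
    (hA2 : ∀ (C : ℝ), 0 < C → ∀ (v : ℝ → EuclideanSpace ℝ (Fin 3) → EuclideanSpace ℝ (Fin 3)), Literature.Analysis.FluidPDE.IsTypeIAncientMild C v → ¬ (∀ t < 0, ∀ x, v t x = 0) → ∃ C₀ : ℝ, 0 < C₀ ∧ ∃ (α : ℝ) (u : ℝ → EuclideanSpace ℝ (Fin 3) → EuclideanSpace ℝ (Fin 3)) (p : ℝ → EuclideanSpace ℝ (Fin 3) → ℝ) (U : EuclideanSpace ℝ (Fin 3) → EuclideanSpace ℝ (Fin 3)), Literature.Analysis.FluidPDE.IsClassicalNSSolutionOn (Set.Ico (-1) 0) 1 0 u p ∧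 (∀ t ∈ Set.Ico (-1 : ℝ) 0, ∀ x : EuclideanSpace ℝ (Fin 3), ‖u t x‖ ≤ C₀ / (‖x‖ + Real.sqrt (-t))) ∧ ContDiff ℝ 2 U ∧ (∀ t ∈ Set.Ico (-1 : ℝ) 0, ∀ x : EuclideanSpace ℝ (Fin 3), u t x = Literature.Analysis.FluidPDE.pvAnsatz α (fun y _ => U y) t x) ∧ U ≠ 0)
    (h8216 : Summit.NavierStokesRegularity.NavierStokesRegularity.Theses.ExtremalTypeIConstant.SpiralScalingLiouville) :
    Summit.NavierStokesRegularity.NavierStokesRegularity.Theses.TypeICertificateLadder.NoTypeIBlowup := by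
  refine noTypeIBlowup_of_rateClassLiouville fun C hC v hv => ?_
  by_contra hnz
  obtain ⟨C₀, hC₀, α, u, p, U, hns, hI, hU, hA, hU0⟩ := hA2 C hC v hv hnz
  exact hU0 (solitonBridge_rssLiouville_of_spiralScalingLiouville h8216 C₀ hC₀ α u p U hns hI hU hA)

/-- **B5b VERBATIM from stmt-8216** (registered stub of the lead's DAG programme): the registered
signature of the line's open window stub `stub_windowLiouville` — Type-I RSS solitons of Pineau–Vicol's
class with rotation rate in a compact window, carrying a rotating conjugate density with the soliton law
and identity — follows from `ExtremalTypeIConstant.SpiralScalingLiouville` (the extra window / density /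
law hypotheses are simply not used: `solitonBridge_rssLiouville_of_spiralScalingLiouville` already gives
`U = 0` for every `α`). CONDITIONAL on the open item 8216; it does not close B5b. [cite: PineauVicol2026, Conjecture 1.1 and Theorem 1.4 (arXiv:2607.09619 pp. 3–4)] -/
theorem solitonBridge_windowLiouville_of_spiralScalingLiouville :
    Summit.NavierStokesRegularity.NavierStokesRegularity.Theses.ExtremalTypeIConstant.SpiralScalingLiouville → ∀ C₀ : ℝ, 0 < C₀ → ∀ a₀ A₀ : ℝ, 0 < a₀ → a₀ ≤ A₀ → ∀ α : ℝ, a₀ ≤ |α| → |α| ≤ A₀ → ∀ (u : ℝ → EuclideanSpace ℝ (Fin 3) → EuclideanSpace ℝ (Fin 3)) (p : ℝ → EuclideanSpace ℝ (Fin 3) → ℝ) (U : EuclideanSpace ℝ (Fin 3) → EuclideanSpace ℝ (Fin 3)) (m : EuclideanSpace ℝ (Fin 3) → ℝ) (c M₁ : ℝ), Literature.Analysis.FluidPDE.IsClassicalNSSolutionOn (Set.Ico (-1) 0) 1 0 u p → (∀ t ∈ Set.Ico (-1 : ℝ) 0, ∀ x : EuclideanSpace ℝ (Fin 3), ‖u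 t x‖ ≤ C₀ / (‖x‖ + Real.sqrt (-t))) → ContDiff ℝ 2 U → (∀ t ∈ Set.Ico (-1 : ℝ) 0, ∀ x : EuclideanSpace ℝ (Fin 3), u t x = Literature.Analysis.FluidPDE.pvAnsatz α (fun y _ => U y) t x) → 0 < c → 0 < M₁ → (ContDiff ℝ 2 m ∧ (∀ y, 0 < m y) ∧ (∫ y, m y = 1) ∧ (∀ y, c * Real.exp (-(7 / 16 : ℝ) * ‖y‖ ^ 2) ≤ m y) ∧ (∀ y, m y ≤ M₁ * Real.exp (-(1 / 16 : ℝ) * ‖y‖ ^ 2)) ∧ (∃ M₂ : ℝ, ∀ y, ‖fderiv ℝ m y‖ ≤ M₂ * Real.exp (-(1 / 32 : ℝ) * ‖y‖ ^ 2)) ∧ (∀ y, Laplacian.laplacian m y + Literature.Analysis.FluidPDE.VectorCalculus.divergence (fun z => m z • (U z + (1 / 2 : ℝ) • z - α • Literature.Analysis.FluidPDE.rotGen z)) y = 0)) → (∫ y, ‖Literature.Analysis.FluidPDE.curl U y‖ ^ 2 * m y ≤ 4 * α ^ 2) → (∫ y, ‖Literature.Analysis.FluidPDE.curl U y‖ ^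 2 * m y = 2 * α * ∫ y, (Literature.Analysis.FluidPDE.curl U y) 2 * m y) → U = 0 := by
  intro h8216 C₀ hC₀ a₀ A₀ _ _ α _ _ u p U m c M₁ hsol hI hU hA _ _ _ _ _
  exact solitonBridge_rssLiouville_of_spiralScalingLiouville h8216 C₀ hC₀ α u p U hsol hI hU hA

end Summit.NavierStokesRegularity.NavierStokesRegularity.Theorems

end
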